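import Summits.QuantumFields.QCD.Theorems.GaussianLinkFramesFrameFMClosureTwoStarOfPaddedAux2
import Summits.QuantumFields.QCD.Theorems.GaussianLinkFramesFrameFMClosureTwoStarOfPaddedAux3

/-!
# Crux `GaussianLinkFrames.FrameFMClosure` (stmt-QuantumFields-17375), line `pad-the-fibre`, stub
`stub_twoStarOfPadded` — helper 4: the two-star package from REGION-WISE cofactor domination

**Theorem (`twoStarBounds_of_regionDomination`).**  The fibre band law, one invertible field per admissible side matrix
(`SideWitness`) and REGION-WISE cofactor domination with a link budget `n` — i.e. one constant `C₀` such that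
(sides) for every probe mass `m₀ ∈ [-9,1]`, odd torus, admissible side `A` and `a, b ∈ A` SOME refit region `R` of `≤ n`
links carries `‖adj (D_A ⊕ 1)_{ab}‖₁ ≤ C₀ sup_fibre |det (D_A ⊕ 1)|` along its fibre over every outside field, and
(collar) for every thick collar `W = ebox(x,ℓ) ⊂ Λ = ebox(x,3ℓ+2)` (`1 ≤ ℓ`, `3ℓ+4 ≤ S`) and `u', v ∈ Λ ∖ W` some region
of `≤ n` links without links inside `W` or inside `Λᶜ` dominates the `(u',v)` block of `adj D` — imply the packaged
two-star bounds (T0), (Tinv), (T5), (Tdec), (T1) of `TwoStarBounds N_f` for every `N_f`.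

This is the landed `VonMisesCirclesC1.stub_twoStar` with its only use of K1♭ (domination on every super-fibre of the
two stars, band law at `32` links) factored through the two region hypotheses; K1♭ gives them with `n = 16`
(`regionDomination_of_localCofactorDomination`, the two stars themselves), and the padded domination of this line is
to give them with `n = 16 + 2·768` (stars ∪ canonical pad regions with balanced touched region) — that placement
combinatorics is NOT in this file.  Proof: helpers 1–3 (`fibre_T5_of_dom`, `fibre_Tdec_of_dom`, `fibre_T1_of_dom` and
their integrated forms), (Tinv) verbatim (`ae_sideMatrix_det_ne_zero`), positivity of the phase-quenched denominator
(`integral_norm_det_diracMatrix_pos_all`); constants `s₀ = min (s₁/3) (1/2)`, `C = max C₀ 1 · 144 · (max C₁ 1)²`,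
`p = 2 max p₁ 0` as in the template.

References: Aizenman–Schenker–Friedrich–Hundertmark, CMP 224 (2001) 219, Lemmas 4–6, (2.17), App. A [AizenmanEtAl2001].
-/

noncomputable section

open scoped BigOperators ENNReal
open MeasureTheory
open Literature.MathematicalPhysics.QuantumFieldTheory Literature.MathematicalPhysics.QuantumLattice
  Literature.Probability.LatticeModels
open Summit.QuantumFields.QCD.Theorems.VonMisesCircles Summit.QuantumFields.QCD.Theorems.VonMisesCirclesC1

namespace Summit.QuantumFields.QCD.Theorems.PadTheFibreTwoStar

section Generic

variable {Nf n : ℕ} {s₁ C₁ p₁ C₀ m₀ : ℝ}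

variable (hB : ∀ (N : ℕ) [NeZero N] (R : Finset (Edge 4 N)), R.card ≤ n →
    ∀ (U : GaugeConfig 4 N (Matrix.specialUnitaryGroup (Fin 3) ℂ)) (β : ℝ)
      (P Q : GaugeConfig 4 N (Matrix.specialUnitaryGroup (Fin 3) ℂ) → ℂ),
      IsFibrePoly (4 * Nf + 4) P → IsFibrePoly (4 * Nf + 4) Q →
      let refit : GaugeConfig 4 N (Matrix.specialUnitaryGroup (Fin 3) ℂ) →
          GaugeConfig 4 N (Matrix.specialUnitaryGroup (Fin 3) ℂ) := fun W e => if e ∈ R then W e else U e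
      let wt : GaugeConfig 4 N (Matrix.specialUnitaryGroup (Fin 3) ℂ) → ℝ := fun W =>
        Real.exp (-(β * wilsonAction (fundamentalRep (Fin 3)) (refit W))) * ‖P (refit W)‖
      let haar : Measure (GaugeConfig 4 N (Matrix.specialUnitaryGroup (Fin 3) ℂ)) :=
        Measure.pi fun _ => haarProbability (Matrix.specialUnitaryGroup (Fin 3) ℂ)
      let Z : ℝ := ∫ W, wt W ∂haar
      (∃ W, P (refit W) ≠ 0) →
        ((∃ W, Q (refit W) ≠ 0) → ∀ᵐ W ∂haar, Q (refit W) ≠ 0) ∧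
        (∀ W₀ : GaugeConfig 4 N (Matrix.specialUnitaryGroup (Fin 3) ℂ),
          ‖Q (refit W₀)‖ ≤ C₁ * (1 + |β|) ^ p₁ * ((∫ W, ‖Q (refit W)‖ * wt W ∂haar) / Z)) ∧
        (∀ s : ℝ, 0 < s → s ≤ s₁ →
          Integrable (fun W => ‖Q (refit W)‖ ^ (-s) * wt W) haar ∧
          (∫ W, ‖Q (refit W)‖ ^ (-s) * wt W ∂haar) / Z ≤
            C₁ * (1 + |β|) ^ p₁ *
              (⨆ W : GaugeConfig 4 N (Matrix.specialUnitaryGroup (Fin 3) ℂ), ‖Q (refit W)‖) ^ (-s)))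
  (hC₁ : 0 < C₁) (hC₀ : 0 < C₀)

include hB hC₁ hC₀

/-- **Clause (Tdec) of `TwoStarBounds` from dominated regions** (ASFH Lemma 6, averaged): a region `R` of `≤ n` links
dominating `(A, a, b)` over every outside field and a region `Rcd` of `≤ n` links dominating `(univ, c, d)` (for the
integrability of the reference functional) give, for `0 < s ≤ 1`, `2s ≤ s₁`,
`pqE[‖G_A(a,b)‖₁^s ‖D⁻¹(c,d)‖₁^s] ≤ C₀^s 144^s (C₁(1+|β|)^{p₁})² · pqE[‖D⁻¹(c,d)‖₁^s]`. [cite: AizenmanEtAl2001, Lemma 6] -/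
theorem Tdec_of_dom {S : ℕ} (β : ℝ) (mq : Fin Nf → ℝ) (A : Finset (TorusSite 4 (2 * S + 1)))
    (a b c d : TorusSite 4 (2 * S + 1)) (R : Finset (Edge 4 (2 * S + 1))) (hRcard : R.card ≤ n)
    (hdom : ∀ U W : GaugeConfig 4 (2 * S + 1) (Matrix.specialUnitaryGroup (Fin 3) ℂ),
      blockNorm ((sideMatrix A (wilsonD (fun e => if e ∈ R then W e else U e) m₀)).adjugate) a b ≤
        C₀ * ⨆ W' : GaugeConfig 4 (2 * S + 1) (Matrix.specialUnitaryGroup (Fin 3) ℂ),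
          ‖(sideMatrix A (wilsonD (fun e => if e ∈ R then W' e else U e) m₀)).det‖)
    (Rcd : Finset (Edge 4 (2 * S + 1))) (hRcd : Rcd.card ≤ n)
    (hdomcd : ∀ U W : GaugeConfig 4 (2 * S + 1) (Matrix.specialUnitaryGroup (Fin 3) ℂ),
      blockNorm ((sideMatrix Finset.univ (wilsonD (fun e => if e ∈ Rcd then W e else U e) m₀)).adjugate) c d ≤
        C₀ * ⨆ W' : GaugeConfig 4 (2 * S + 1) (Matrix.specialUnitaryGroup (Fin 3) ℂ),
          ‖(sideMatrix Finset.univ (wilsonD (fun e => if e ∈ Rcd then W' e else U e) m₀)).det‖)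
    (s : ℝ) (hs : 0 < s) (hs1 : s ≤ 1) (hs2 : 2 * s ≤ s₁) :
    pqE Nf S β mq (fun U => blockNorm (gside A (wilsonD U m₀)) a b ^ s * blockNorm (wilsonD U m₀)⁻¹ c d ^ s) ≤
      C₀ ^ s * (144 : ℝ) ^ s * (C₁ * (1 + |β|) ^ p₁) ^ 2 *
        pqE Nf S β mq (fun U => blockNorm (wilsonD U m₀)⁻¹ c d ^ s) := by
  have hss : s ≤ s₁ := by linarith
  refine pqE_le_mul_pqE_of_fibre_bound β mq _ _
    (fun U => mul_nonneg (Real.rpow_nonneg (blockNorm_nonneg _ _ _) _) (Real.rpow_nonneg (blockNorm_nonneg _ _ _) _))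
    (fun U => Real.rpow_nonneg (blockNorm_nonneg _ _ _) _)
    (((measurable_blockNorm_gside A m₀ a b).pow_const s).mul ((measurable_blockNorm_inv_wilsonD m₀ c d).pow_const s))
    ((measurable_blockNorm_inv_wilsonD m₀ c d).pow_const s)
    (T5_inv_of_dom hB hC₁ hC₀ β mq c d Rcd hRcd hdomcd s hs hss).2 ?_ R
    fun U => fibre_Tdec_of_dom hB hC₁ hC₀ β mq A a b c d R hRcard s hs hs1 hs2 U (hdom U)
  exact mul_nonneg (mul_nonneg (Real.rpow_nonneg hC₀.le _) (Real.rpow_nonneg (by norm_num) _)) (sq_nonneg _)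

end Generic

/-- **The two-star package from region-wise cofactor domination.**  `FibreBandLaw`, `SideWitness` and the two
region hypotheses — (sides) a dominated region of `≤ n` links for every admissible side `A`, `a, b ∈ A`, probe mass in
`[-9,1]`; (collar) for every thick collar and `u', v ∈ Λ ∖ W` a dominated region of `≤ n` links for `(univ, u', v)`
without links inside `W` or inside `Λᶜ` — give `TwoStarBounds N_f` for every `N_f`.  The registered helper
`stub_twoStarOfPadded_aux4` of crux stmt-QuantumFields-17375 (line `pad-the-fibre`, stub `stub_twoStarOfPadded`).
[cite: AizenmanEtAl2001, Lemmas 4–6] -/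
theorem twoStarBounds_of_regionDomination (hFBL : FibreBandLaw) (hSW : SideWitness) (n : ℕ) (C₀ : ℝ)
    (hC₀ : 0 < C₀)
    (hSide : ∀ (m₀ : ℝ), -9 ≤ m₀ → m₀ ≤ 1 →
      ∀ (S : ℕ) (A : Finset (TorusSite 4 (2 * S + 1))), AdmissibleSide S A →
      ∀ (a b : TorusSite 4 (2 * S + 1)), a ∈ A → b ∈ A →
      ∃ R : Finset (Edge 4 (2 * S + 1)), R.card ≤ n ∧
        ∀ U W : GaugeConfig 4 (2 * S + 1) (Matrix.specialUnitaryGroup (Fin 3) ℂ),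
          blockNorm ((sideMatrix A (wilsonD (fun e => if e ∈ R then W e else U e) m₀)).adjugate) a b ≤
            C₀ * ⨆ W' : GaugeConfig 4 (2 * S + 1) (Matrix.specialUnitaryGroup (Fin 3) ℂ),
              ‖(sideMatrix A (wilsonD (fun e => if e ∈ R then W' e else U e) m₀)).det‖)
    (hCollar : ∀ (m₀ : ℝ), -9 ≤ m₀ → m₀ ≤ 1 →
      ∀ (S : ℕ) (x : TorusSite 4 (2 * S + 1)) (ℓ : ℕ), 1 ≤ ℓ → 3 * ℓ + 4 ≤ S →
      ∀ (u' v : TorusSite 4 (2 * S + 1)),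
        u' ∈ ebox S x (3 * ℓ + 2) → u' ∉ ebox S x ℓ → v ∈ ebox S x (3 * ℓ + 2) → v ∉ ebox S x ℓ →
      ∃ R : Finset (Edge 4 (2 * S + 1)), R.card ≤ n ∧
        (∀ e ∈ R, ¬(e.1 ∈ ebox S x ℓ ∧ Site.shift e.1 e.2 ∈ ebox S x ℓ)) ∧
        (∀ e ∈ R, ¬(e.1 ∈ (ebox S x (3 * ℓ + 2))ᶜ ∧ Site.shift e.1 e.2 ∈ (ebox S x (3 * ℓ + 2))ᶜ)) ∧
        ∀ U W : GaugeConfig 4 (2 * S + 1) (Matrix.specialUnitaryGroup (Fin 3) ℂ),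
          blockNorm ((sideMatrix Finset.univ (wilsonD (fun e => if e ∈ R then W e else U e) m₀)).adjugate) u' v ≤
            C₀ * ⨆ W' : GaugeConfig 4 (2 * S + 1) (Matrix.specialUnitaryGroup (Fin 3) ℂ),
              ‖(sideMatrix Finset.univ (wilsonD (fun e => if e ∈ R then W' e else U e) m₀)).det‖) :
    ∀ Nf : ℕ, TwoStarBounds Nf := by
  intro Nf
  obtain ⟨sB, C₁, p₁, hsB, hC₁, hB⟩ := hFBL n (4 * Nf + 4)
  -- constants
  have hM₀ : 1 ≤ max C₀ 1 := le_max_right _ _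
  have hM₁ : 1 ≤ max C₁ 1 := le_max_right _ _
  refine ⟨min (sB / 3) (1 / 2), max C₀ 1 * 144 * max C₁ 1 ^ 2, 2 * max p₁ 0,
    lt_min (by linarith) (by norm_num), (min_le_right _ _).trans_lt (by norm_num), by positivity, ?_⟩
  intro s hs hss₀ β mq f hm₁ hm₂ S
  have hs3 : 3 * s ≤ sB := by have := min_le_left (sB / 3) (1 / 2); linarith
  have hs2 : 2 * s ≤ sB := by linarith
  have hs1 : s ≤ 1 := by have := min_le_right (sB / 3) (1 / 2); linarith
  have hssB : s ≤ sB := by linarith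
  have hSd := hSide (mq f) hm₁ hm₂ S
  have hCl := hCollar (mq f) hm₁ hm₂ S
  -- constant bookkeeping
  have hβ1 : 1 ≤ 1 + |β| := by have := abs_nonneg β; linarith
  have hp₁le : p₁ ≤ 2 * max p₁ 0 := by
    have h1 := le_max_left p₁ 0; have h2 := le_max_right p₁ 0; linarith
  have hpow1 : (1 + |β|) ^ p₁ ≤ (1 + |β|) ^ (2 * max p₁ 0) := Real.rpow_le_rpow_of_exponent_le hβ1 hp₁le
  have hpow2 : ((1 + |β|) ^ p₁) ^ 2 ≤ (1 + |β|) ^ (2 * max p₁ 0) := by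
    rw [← Real.rpow_natCast, ← Real.rpow_mul (by positivity)]
    refine Real.rpow_le_rpow_of_exponent_le hβ1 ?_
    have h1 := le_max_left p₁ 0; have h2 := le_max_right p₁ 0
    push_cast
    nlinarith
  have hC₀s : C₀ ^ s ≤ max C₀ 1 := by
    rcases le_or_gt 1 C₀ with h1 | h1
    · calc C₀ ^ s ≤ C₀ ^ (1 : ℝ) := Real.rpow_le_rpow_of_exponent_le h1 hs1
        _ = C₀ := Real.rpow_one _
        _ ≤ max C₀ 1 := le_max_left _ _
    · exact (Real.rpow_le_one hC₀.le h1.le hs.le).trans (le_max_right _ _)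
  have h144s : (144 : ℝ) ^ s ≤ 144 := by
    calc (144 : ℝ) ^ s ≤ 144 ^ (1 : ℝ) := Real.rpow_le_rpow_of_exponent_le (by norm_num) hs1
      _ = 144 := Real.rpow_one _
  have hC₁le : C₁ ≤ max C₁ 1 := le_max_left _ _
  have hB0 : 0 ≤ (1 + |β|) ^ p₁ := Real.rpow_nonneg (by positivity) _
  have hBp1 : 1 ≤ (1 + |β|) ^ (2 * max p₁ 0) := Real.one_le_rpow hβ1 (by positivity)
  have hC₀s0 : 0 ≤ C₀ ^ s := Real.rpow_nonneg hC₀.le _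
  -- the (T5)/(T1) constant and the (Tdec) constant are dominated by `C (1+|β|)^p`
  have hK5 : C₀ ^ s * (C₁ * (1 + |β|) ^ p₁) ≤
      max C₀ 1 * 144 * max C₁ 1 ^ 2 * (1 + |β|) ^ (2 * max p₁ 0) := by
    calc C₀ ^ s * (C₁ * (1 + |β|) ^ p₁)
        ≤ max C₀ 1 * (max C₁ 1 * (1 + |β|) ^ (2 * max p₁ 0)) :=
          mul_le_mul hC₀s (mul_le_mul hC₁le hpow1 hB0 (zero_le_one.trans hM₁)) (mul_nonneg hC₁.le hB0)
            (zero_le_one.trans hM₀)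
      _ ≤ max C₀ 1 * 144 * max C₁ 1 ^ 2 * (1 + |β|) ^ (2 * max p₁ 0) := by
          have h1 : max C₁ 1 ≤ 144 * max C₁ 1 ^ 2 := by nlinarith
          have h2 : 0 ≤ max C₀ 1 := zero_le_one.trans hM₀
          have h3 : 0 ≤ (1 + |β|) ^ (2 * max p₁ 0) := zero_le_one.trans hBp1
          nlinarith [mul_le_mul_of_nonneg_left h1 h2, mul_nonneg h2 h3]
  have hKdec : C₀ ^ s * (144 : ℝ) ^ s * (C₁ * (1 + |β|) ^ p₁) ^ 2 ≤
      max C₀ 1 * 144 * max C₁ 1 ^ 2 * (1 + |β|) ^ (2 * max p₁ 0) := by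
    have h1 : (C₁ * (1 + |β|) ^ p₁) ^ 2 ≤ max C₁ 1 ^ 2 * (1 + |β|) ^ (2 * max p₁ 0) := by
      rw [mul_pow]
      exact mul_le_mul (pow_le_pow_left₀ hC₁.le hC₁le 2) hpow2 (sq_nonneg _) (sq_nonneg _)
    calc C₀ ^ s * (144 : ℝ) ^ s * (C₁ * (1 + |β|) ^ p₁) ^ 2
        ≤ max C₀ 1 * 144 * (max C₁ 1 ^ 2 * (1 + |β|) ^ (2 * max p₁ 0)) :=
          mul_le_mul (mul_le_mul hC₀s h144s (Real.rpow_nonneg (by norm_num) _) (zero_le_one.trans hM₀)) h1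
            (sq_nonneg _) (mul_nonneg (zero_le_one.trans hM₀) (by norm_num))
      _ = _ := by ring
  have hrad : ∀ r : ℕ, 1 ≤ (1 + (r : ℝ)) ^ (2 * max p₁ 0) := fun r =>
    Real.one_le_rpow (by have := (Nat.cast_nonneg r : (0 : ℝ) ≤ r); linarith) (by positivity)
  have hCB0 : 0 ≤ max C₀ 1 * 144 * max C₁ 1 ^ 2 * (1 + |β|) ^ (2 * max p₁ 0) := by positivity
  have huniv : AdmissibleSide S (Finset.univ : Finset (TorusSite 4 (2 * S + 1))) := Or.inl rfl
  refine ⟨integral_norm_det_diracMatrix_pos_all (S := 2 * S + 1) β mq, ?_, ?_, ?_, ?_, ?_⟩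
  · -- (T0) integrability
    intro t₁ t₂ t₃ h₁ h₁' h₂ h₂' h₃ h₃' A₁ A₂ A₃ hA₁ hA₂ hA₃ a₁ b₁ a₂ b₂ a₃ b₃
    have hs₀3 : 3 * min (sB / 3) (1 / 2) ≤ sB := by have := min_le_left (sB / 3) (1 / 2); linarith
    exact integrable_T0_triple_of_dom hB hC₁ hC₀ β mq t₁ t₂ t₃ h₁ (by linarith) h₂ (by linarith) h₃ (by linarith)
      A₁ A₂ A₃ a₁ b₁ a₂ b₂ a₃ b₃ (hSd A₁ hA₁ a₁ b₁) (hSd A₂ hA₂ a₂ b₂) (hSd A₃ hA₃ a₃ b₃)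
  · -- (Tinv)
    intro A hA
    exact ae_sideMatrix_det_ne_zero hFBL hSW β (mq f) hm₁ hm₂ A hA
  · -- (T5)
    intro x y
    obtain ⟨R, hRcard, hdom⟩ := hSd Finset.univ huniv x y (Finset.mem_univ _) (Finset.mem_univ _)
    exact (T5_inv_of_dom hB hC₁ hC₀ β mq x y R hRcard hdom s hs hssB).1.trans hK5
  · -- (Tdec)
    intro x r hr1 hrS A hA3 a b c d ha hb
    have hA : AdmissibleSide S A := Or.inr ⟨x, r, hr1, hrS, hA3⟩
    obtain ⟨R, hRcard, hdom⟩ := hSd A hA a b ha hb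
    obtain ⟨Rcd, hRcd, hdomcd⟩ := hSd Finset.univ huniv c d (Finset.mem_univ _) (Finset.mem_univ _)
    refine (Tdec_of_dom hB hC₁ hC₀ β mq A a b c d R hRcard hdom Rcd hRcd hdomcd s hs hs1 hs2).trans ?_
    refine mul_le_mul_of_nonneg_right (hKdec.trans ?_)
      (pqE_nonneg β mq _ fun U => Real.rpow_nonneg (blockNorm_nonneg _ _ _) _)
    exact le_mul_of_one_le_right hCB0 (hrad r)
  · -- (T1)
    intro x ℓ hℓ hℓS u u' v v' y hu'Λ hu'W hvΛ hvW _hv' _hy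
    obtain ⟨R, hRcard, hRW, hRΛ, hdom⟩ := hCl x ℓ hℓ hℓS u' v hu'Λ hu'W hvΛ hvW
    have hAW : AdmissibleSide S (ebox S x ℓ) := Or.inr ⟨x, ℓ, hℓ, by omega, Or.inl rfl⟩
    have hAΛ : AdmissibleSide S (ebox S x (3 * ℓ + 2))ᶜ :=
      Or.inr ⟨x, 3 * ℓ + 2, by omega, by omega, Or.inr (Or.inl rfl)⟩
    refine (T1_of_dom hB hC₁ hC₀ β mq x ℓ u u' v v' y R hRcard hRW hRΛ hdom (hSd _ hAW x u) (hSd _ hAΛ v' y)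
      s hs hs3).trans ?_
    refine mul_le_mul_of_nonneg_right (hK5.trans ?_)
      (pqE_nonneg β mq _ fun U => mul_nonneg (Real.rpow_nonneg (blockNorm_nonneg _ _ _) _)
        (Real.rpow_nonneg (blockNorm_nonneg _ _ _) _))
    exact le_mul_of_one_le_right hCB0 (hrad ℓ)

/-- **Registered helper `stub_twoStarOfPadded_aux4` of crux stmt-QuantumFields-17375** (line `pad-the-fibre`, stub
`stub_twoStarOfPadded`): the two-star package `∀ N_f, TwoStarBounds N_f` from the fibre band law, the side witnesses and
REGION-WISE cofactor domination with a link budget `n` (sides + collar hypotheses), one line. [cite: AizenmanEtAl2001, Lemmas 4–6] -/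
theorem stub_twoStarOfPadded_aux4 : FibreBandLaw → SideWitness → ∀ (n : ℕ) (C₀ : ℝ), 0 < C₀ → (∀ (m₀ : ℝ), -9 ≤ m₀ → m₀ ≤ 1 → ∀ (S : ℕ) (A : Finset (TorusSite 4 (2 * S + 1))), AdmissibleSide S A → ∀ (a b : TorusSite 4 (2 * S + 1)), a ∈ A → b ∈ A → ∃ R : Finset (Edge 4 (2 * S + 1)), R.card ≤ n ∧ ∀ U W : GaugeConfig 4 (2 * S + 1) (Matrix.specialUnitaryGroup (Fin 3) ℂ), blockNorm ((sideMatrix A (wilsonD (fun e => if e ∈ R then W e else U e) m₀)).adjugate) a b ≤ C₀ * ⨆ W' : GaugeConfig 4 (2 * S + 1) (Matrix.specialUnitaryGroup (Fin 3) ℂ), ‖(sideMatrix A (wilsonD (fun e => if e ∈ R then W' e else U e) m₀)).det‖) → (∀ (m₀ : ℝ), -9 ≤ m₀ → m₀ ≤ 1 → ∀ (S : ℕ) (x : TorusSite 4 (2 * S + 1)) (ℓ : ℕ), 1 ≤ ℓ → 3 * ℓ + 4 ≤ S → ∀ (u' v : TorusSite 4 (2 * S + 1)), u' ∈ ebox S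 x (3 * ℓ + 2) → u' ∉ ebox S x ℓ → v ∈ ebox S x (3 * ℓ + 2) → v ∉ ebox S x ℓ → ∃ R : Finset (Edge 4 (2 * S + 1)), R.card ≤ n ∧ (∀ e ∈ R, ¬(e.1 ∈ ebox S x ℓ ∧ Site.shift e.1 e.2 ∈ ebox S x ℓ)) ∧ (∀ e ∈ R, ¬(e.1 ∈ (ebox S x (3 * ℓ + 2))ᶜ ∧ Site.shift e.1 e.2 ∈ (ebox S x (3 * ℓ + 2))ᶜ)) ∧ ∀ U W : GaugeConfig 4 (2 * S + 1) (Matrix.specialUnitaryGroup (Fin 3) ℂ), blockNorm ((sideMatrix Finset.univ (wilsonD (fun e => if e ∈ R then W e else U e) m₀)).adjugate) u' v ≤ C₀ * ⨆ W' : GaugeConfig 4 (2 * S + 1) (Matrix.specialUnitaryGroup (Fin 3) ℂ), ‖(sideMatrix Finset.univ (wilsonD (fun e => if e ∈ R then W' e else U e) m₀)).det‖) → ∀ Nf : ℕ, TwoStarBounds Nf :=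
  fun hFBL hSW n C₀ hC₀ hSide hCollar => twoStarBounds_of_regionDomination hFBL hSW n C₀ hC₀ hSide hCollar

/-- **K1♭ is region-wise domination with `n = 16`** (the two stars themselves): `LocalCofactorDomination` gives the
(sides) and (collar) hypotheses of `twoStarBounds_of_regionDomination` — for the collar the two-star links join neither
two sites of `W` (`u', v ∉ W`) nor two sites of `Λᶜ` (`u', v ∈ Λ`).  Sanity instance of the factorisation: composed with
`twoStarBounds_of_regionDomination` it re-derives the landed `VonMisesCirclesC1.stub_twoStar` (not restated here). [folklore] -/
theorem regionDomination_of_localCofactorDomination (hK1 : LocalCofactorDomination) :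
    ∃ C₀ : ℝ, 0 < C₀ ∧
    (∀ (m₀ : ℝ), -9 ≤ m₀ → m₀ ≤ 1 →
      ∀ (S : ℕ) (A : Finset (TorusSite 4 (2 * S + 1))), AdmissibleSide S A →
      ∀ (a b : TorusSite 4 (2 * S + 1)), a ∈ A → b ∈ A →
      ∃ R : Finset (Edge 4 (2 * S + 1)), R.card ≤ 16 ∧
        ∀ U W : GaugeConfig 4 (2 * S + 1) (Matrix.specialUnitaryGroup (Fin 3) ℂ),
          blockNorm ((sideMatrix A (wilsonD (fun e => if e ∈ R then W e else U e) m₀)).adjugate) a b ≤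
            C₀ * ⨆ W' : GaugeConfig 4 (2 * S + 1) (Matrix.specialUnitaryGroup (Fin 3) ℂ),
              ‖(sideMatrix A (wilsonD (fun e => if e ∈ R then W' e else U e) m₀)).det‖) ∧
    (∀ (m₀ : ℝ), -9 ≤ m₀ → m₀ ≤ 1 →
      ∀ (S : ℕ) (x : TorusSite 4 (2 * S + 1)) (ℓ : ℕ), 1 ≤ ℓ → 3 * ℓ + 4 ≤ S →
      ∀ (u' v : TorusSite 4 (2 * S + 1)),
        u' ∈ ebox S x (3 * ℓ + 2) → u' ∉ ebox S x ℓ → v ∈ ebox S x (3 * ℓ + 2) → v ∉ ebox S x ℓ →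
      ∃ R : Finset (Edge 4 (2 * S + 1)), R.card ≤ 16 ∧
        (∀ e ∈ R, ¬(e.1 ∈ ebox S x ℓ ∧ Site.shift e.1 e.2 ∈ ebox S x ℓ)) ∧
        (∀ e ∈ R, ¬(e.1 ∈ (ebox S x (3 * ℓ + 2))ᶜ ∧ Site.shift e.1 e.2 ∈ (ebox S x (3 * ℓ + 2))ᶜ)) ∧
        ∀ U W : GaugeConfig 4 (2 * S + 1) (Matrix.specialUnitaryGroup (Fin 3) ℂ),
          blockNorm ((sideMatrix Finset.univ (wilsonD (fun e => if e ∈ R then W e else U e) m₀)).adjugate) u' v ≤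
            C₀ * ⨆ W' : GaugeConfig 4 (2 * S + 1) (Matrix.specialUnitaryGroup (Fin 3) ℂ),
              ‖(sideMatrix Finset.univ (wilsonD (fun e => if e ∈ R then W' e else U e) m₀)).det‖) := by
  obtain ⟨C₀, hC₀, hK⟩ := adj_blockNorm_le_sup_of_localCofactorDomination hK1
  refine ⟨C₀, hC₀, ?_, ?_⟩
  · intro m₀ hm₁ hm₂ S A hA a b ha hb
    refine ⟨Finset.univ.filter fun e : Edge 4 (2 * S + 1) =>
      e.1 = a ∨ Site.shift e.1 e.2 = a ∨ e.1 = b ∨ Site.shift e.1 e.2 = b, card_filter_twoStar_le a b, ?_⟩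
    intro U W
    exact hK m₀ hm₁ hm₂ S A hA a b ha hb _ (fun e he => Finset.mem_filter.2 ⟨Finset.mem_univ _, he⟩) U W
  · intro m₀ hm₁ hm₂ S x ℓ _ _ u' v hu'Λ hu'W hvΛ hvW
    refine ⟨Finset.univ.filter fun e : Edge 4 (2 * S + 1) =>
      e.1 = u' ∨ Site.shift e.1 e.2 = u' ∨ e.1 = v ∨ Site.shift e.1 e.2 = v, card_filter_twoStar_le u' v,
      fun e he => not_both_mem_of_twoStar hu'W hvW e (Finset.mem_filter.1 he).2,
      fun e he => not_both_mem_compl_of_twoStar hu'Λ hvΛ e (Finset.mem_filter.1 he).2, ?_⟩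
    intro U W
    exact hK m₀ hm₁ hm₂ S Finset.univ (Or.inl rfl) u' v (Finset.mem_univ _) (Finset.mem_univ _) _
      (fun e he => Finset.mem_filter.2 ⟨Finset.mem_univ _, he⟩) U W

end Summit.QuantumFields.QCD.Theorems.PadTheFibreTwoStar
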